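import Summits.BirchSwinnertonDyer.BirchSwinnertonDyer.Theorems.ManinLocalTwoThreeShimuraQuotientCuspidalInertia
import Summits.BirchSwinnertonDyer.BirchSwinnertonDyer.Theorems.ManinLocalTwoThreeShimuraQuotientFourP
import HarnessLib

/-!
# Level instances of the cuspidal-inertia reduction: index `4` (`Λ₁ = 2Λ₀`) EXCLUDED at `N = 8p, 16p, 32, 64, 128, 256, …`;
# `Λ₁(f) = Λ₀(f)` (Stevens' curve = the optimal curve) at `N = 9M` with `3 ∤ φ(3M)` and at `N = 4q^e`, `q ≡ 3 (mod 4)`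
Summit `BirchSwinnertonDyer`, route `ManinLocalTwoThree` (cell bsd-f2-manin), cruxes C2 `ManinOddAtFour`
(stmt-BirchSwinnertonDyer-22967) / C3 `ManinPrimeToThreeAtNine` (stmt-BirchSwinnertonDyer-22968); lead p1 gen 15.  Sequel to
`Theorems/ManinLocalTwoThreeShimuraQuotientCuspidalInertia.lean` (the Shimura quotient `Λ₀(f)/Λ₁(f)` is a quotient of
`(ℤ/uv)ˣ/{±1}` for every `N = u²v`).
* §5 `not_index_four_of_two_classes` (a Shimura quotient with `≤ 2` classes never has `Λ₁ = 2Λ₀` on a lattice-optimal datum —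
  the tree's `N = 4q` argument made level-free), `two_mul_mem_periodLatticeGamma1_of_four_dvd`, and the LEVEL INSTANCES of
  E-an-152b `ShimuraKernel.ShimuraIndexNeFourAtFour` (index `≠ 4`), UNCONDITIONAL: `not_periodLatticeGamma1_eq_two_mul_of_generator_mod`
  (units of `ℤ/uv` are `± u₀^k`), `…_of_isCyclic_mod`, **`…_of_uv_eq_four_mul`** (`uv = 4q`, `q` odd, `(ℤ/q)ˣ` cyclic: `N = 8q^j,
  16q^j, 16q², …`), **`…_eight_mul_prime` / `…_sixteen_mul_prime`** (`N = 8p`, `16p`), **`…_of_uv_eq_eight` / `…_of_uv_eq_sixteen` /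
  `…_of_two_power`** (`N ∈ {32, 64, 128, 256}` — the CM / twist-minimal core classes `32a, 64a, 128a–d, 256a–d` of C2's line v21).
  Before: E-an-152b was a theorem only at `N = 4q` (`…ShimuraQuotientFourP`) and for non-rectangular lattices (`…ShimuraQuotientConjugation`);
  `32a, 64a` ARE rectangular with full rational `2`-torsion, so these levels are new.
* §6 `pow_half_totient_eq_one_or_eq_neg_one` (Lagrange in `(ℤ/m)ˣ/{±1}`: `x^{φ(m)/2} = ±1` for `m > 2`),
  `half_totient_mul_mem_periodLatticeGamma1_mod` (`(φ(uv)/2)·Λ₀ ⊆ Λ₁`), **`periodLatticeGamma1_eq_of_natMul_mem_of_coprime_half_totient`**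
  (`pΛ₀ ⊆ Λ₁`, `p ∤ φ(uv)/2` ⟹ `Λ₁ = Λ₀` — the `p`-part of `(ℤ/uv)ˣ/{±1}` is trivial);
* §7 `three_mul_mem_periodLatticeGamma1_of_nine_dvd`, **`periodLatticeGamma1_eq_of_nine_mul_of_coprime_totient`** (`N = 9M`,
  `3 ∤ φ(3M)` ⟹ `Λ₁(f) = Λ₀(f)`: Stevens' curve is the optimal curve and `|c₀| = |c₁|` by the tree's
  `natAbs_maninConstant₀_eq_of_periodLatticeGamma1_eq_periodLattice`), **`periodLatticeGamma1_eq_of_nine_mul_prime`** (`N = 9p`,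
  `p ≡ 2 (mod 3)`; the tree knew «`≤ 3` classes» there, `…PeriodLatticeGamma1QuotientProofs`) — es census E15: `N = 18, 45, 90, 99,
  153, …` all index `1` ✓; and the `p = 2` twin **`periodLatticeGamma1_eq_of_four_mul_prime_pow`** / **`…_of_four_mul_prime`**:
  `N = 4q^e`, `q ≡ 3 (mod 4)` ⟹ `Λ₁(f) = Λ₀(f)` UNCONDITIONALLY (`(ℤ/2q^e)ˣ/{±1}` has odd order) — `N = 28, 44, 76, 92, 108, 124,
  172, …`; es census E15 ✓ (index `2` at `N = 4·odd ≤ 356` occurs exactly at `20, 52, 116, 212`, all `q ≡ 1 (mod 4)`).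
STILL OPEN for E-an-152b: `N = 2^e M` (`M` odd squarefree) with `(ℤ/uv)ˣ/⟨−1⟩` of `2`-rank `≥ 2`: `e ≥ 5 ∧ ω(M) ≥ 1` (`96, 160, …`),
`e ∈ {3,4} ∧ ω(M) ≥ 2` (`120, 168, 240, …`), `e = 2 ∧ (ω(M) ≥ 3 ∨ M = qr, q ≡ r ≡ 1 (4))` (`260, 340, 420, …`).
HONEST FRAMING: unconditional structure theorems; C2, C3, Manin's conjecture and BSD are NOT proved by this file.  No definitions,
no sorry.
[cite: LingOesterle1991, §1, Thm. 1 and Thm. 6 (structure of Σ(N); U_p = p on Σ(N) at a traceless prime)]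
[cite: Stevens1989, §2 (the Shimura covering E₁ → E₀)] [cite: Manin1972, Prop. 1.4 / Thm. 1.6]
-/

set_option autoImplicit false
-- the summit-side namespace `Summit.BirchSwinnertonDyer.BirchSwinnertonDyer.…` is the tree's (summit = sub-problem)
set_option linter.dupNamespace false

noncomputable section

open scoped MatrixGroups ModularForm

open CongruenceSubgroup WeierstrassCurve Literature.NumberTheory.EllipticCurves
  Literature.NumberTheory.EllipticCurves.ModularForms

namespace Summit.BirchSwinnertonDyer.BirchSwinnertonDyer.Theorems.ManinLocalTwoThree

variable {N : ℕ} [NeZero N]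

/-! ## §5 Index `4` (`Λ₁ = 2Λ₀`) is excluded wherever the Shimura quotient has at most two classes -/

section IndexFour

variable {W₀ : WeierstrassCurve ℚ}

/-- **Two classes exclude index `4`.**  If every period is `≡ 0` or `≡ x₀ (mod Λ₁(f))` for one `x₀`, then a lattice-optimal
`X₀(N)`-datum cannot have `Λ₁(f) = 2Λ₀(f)`: `Λ₀/2Λ₀` has the three non-zero classes of `ω₁/c₀, ω₂/c₀, (ω₁+ω₂)/c₀`, and two
of `0, ω₁/c₀, ω₂/c₀, (ω₁+ω₂)/c₀` congruent mod `2Λ₀ ⊆ 2c₀⁻¹Λ_{E₀}` would put a half-period in `Λ_{E₀}` (the tree's argument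
at `N = 4q`, `not_periodLatticeGamma1_eq_two_mul_of_four_mul`, made level-free). [cite: Stevens1989, §2] -/
theorem not_index_four_of_two_classes (D₀ : ModularParametrizationData W₀ N)
    (h₀ : ∀ z ∈ D₀.L.lattice, ∃ w ∈ periodLattice D₀.f, z = D₀.c * w) {x₀ : ℂ}
    (htwo : ∀ z ∈ periodLattice D₀.f, z ∈ periodLatticeGamma1 D₀.f ∨ z - x₀ ∈ periodLatticeGamma1 D₀.f) :
    ¬ (∀ z : ℂ, z ∈ periodLatticeGamma1 D₀.f ↔ ∃ w ∈ periodLattice D₀.f, z = 2 * w) := by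
  intro hidx
  have hc₀ : (D₀.c : ℂ) ≠ 0 := by exact_mod_cast D₀.maninConstant_ne_zero_holds
  set L := D₀.L with hL
  have key : ∀ u ∈ periodLatticeGamma1 D₀.f, (D₀.c : ℂ) * u / 2 ∈ L.lattice := by
    intro u hu
    obtain ⟨w, hw, rfl⟩ := (hidx u).mp hu
    have e : (D₀.c : ℂ) * (2 * w) / 2 = (D₀.c : ℂ) * w := by ring
    rw [e]
    exact D₀.smul_periodLattice_le w hw
  have h1 : L.ω₁ / (D₀.c : ℂ) ∈ periodLattice D₀.f :=
    div_maninConstant_mem_periodLattice_of_optimal D₀ h₀ L.ω₁_mem_lattice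
  have h2 : L.ω₂ / (D₀.c : ℂ) ∈ periodLattice D₀.f :=
    div_maninConstant_mem_periodLattice_of_optimal D₀ h₀ L.ω₂_mem_lattice
  have h12 : (L.ω₁ + L.ω₂) / (D₀.c : ℂ) ∈ periodLattice D₀.f := by
    rw [add_div]; exact add_mem h1 h2
  have n1 : L.ω₁ / 2 ∉ L.lattice := L.ω₁_div_two_notMem_lattice
  have n2 : L.ω₂ / 2 ∉ L.lattice := L.ω₂_div_two_notMem_lattice
  have n12 : (L.ω₁ + L.ω₂) / 2 ∉ L.lattice := by
    have h := (L.mul_ω₁_add_mul_ω₂_mem_lattice (α := 1 / 2) (β := 1 / 2)).not.mpr (by norm_num)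
    intro hmem; apply h
    convert hmem using 1; push_cast; ring
  have n1m2 : (L.ω₁ - L.ω₂) / 2 ∉ L.lattice := by
    have h := (L.mul_ω₁_add_mul_ω₂_mem_lattice (α := 1 / 2) (β := -(1 / 2))).not.mpr (by norm_num)
    intro hmem; apply h
    convert hmem using 1; push_cast; ring
  rcases htwo _ h1 with a1 | a1
  · exact n1 (by simpa [mul_div_cancel₀ _ hc₀, mul_comm] using key _ a1)
  rcases htwo _ h2 with a2 | a2
  · exact n2 (by simpa [mul_div_cancel₀ _ hc₀, mul_comm] using key _ a2)
  rcases htwo _ h12 with a12 | a12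
  · exact n12 (by simpa [mul_div_cancel₀ _ hc₀, mul_comm] using key _ a12)
  have hdiff : L.ω₁ / (D₀.c : ℂ) - L.ω₂ / (D₀.c : ℂ) ∈ periodLatticeGamma1 D₀.f := by
    have h := sub_mem a1 a2
    have e : L.ω₁ / (D₀.c : ℂ) - x₀ - (L.ω₂ / (D₀.c : ℂ) - x₀) = L.ω₁ / (D₀.c : ℂ) - L.ω₂ / (D₀.c : ℂ) := by ring
    rwa [e] at h
  refine n1m2 ?_
  have h := key _ hdiff
  have e : (D₀.c : ℂ) * (L.ω₁ / (D₀.c : ℂ) - L.ω₂ / (D₀.c : ℂ)) / 2 = (L.ω₁ - L.ω₂) / 2 := by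
    field_simp
  rwa [e] at h

/-- `2Λ₀(f) ⊆ Λ₁(f)` for the newform of an `X₀(N)`-datum at `4 ∣ N` (the traceless prime `2`; tree
`pMulLatticeLeGamma1OfTracelessPrime_holds`). [cite: LingOesterle1991, Thm. 6] -/
theorem two_mul_mem_periodLatticeGamma1_of_four_dvd (D₀ : ModularParametrizationData W₀ N) (h4 : 2 ^ 2 ∣ N)
    {z : ℂ} (hz : z ∈ periodLattice D₀.f) : (2 : ℂ) * z ∈ periodLatticeGamma1 D₀.f := by
  have h := pMulLatticeLeGamma1OfTracelessPrime_holds N D₀.f D₀.isNewformOf.1 2 Nat.prime_two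
    ((dvd_pow_self 2 two_ne_zero).trans h4) (D₀.isNewformOf.1.cuspCoeff_eq_zero_of_sq_dvd Nat.prime_two h4) z hz
  exact_mod_cast h

/-- **INDEX `4` EXCLUDED when the units of `ℤ/uv` are `± u₀^k`** (`N = u²v`, `4 ∣ N`, lattice-optimal datum): then
`Λ₁(f) ≠ 2Λ₀(f)` — E-an-152b `ShimuraIndexNeFourAtFour` at every such level, unconditionally.
[cite: LingOesterle1991, §1 and Thm. 6] [cite: Stevens1989, §2] -/
theorem not_periodLatticeGamma1_eq_two_mul_of_generator_mod {u v m : ℕ} (hu : u ≠ 0)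
    (hN : (N : ℤ) = (u : ℤ) ^ 2 * v) (hm : u * v = m) {u₀ : ZMod m} (hu₀ : IsUnit u₀)
    (hgen : ∀ w : (ZMod m)ˣ, ∃ k : ℕ, (w : ZMod m) = u₀ ^ k ∨ (w : ZMod m) = -(u₀ ^ k))
    (D₀ : ModularParametrizationData W₀ N) (h₀ : ∀ z ∈ D₀.L.lattice, ∃ w ∈ periodLattice D₀.f, z = D₀.c * w)
    (h4 : 2 ^ 2 ∣ N) :
    ¬ (∀ z : ℂ, z ∈ periodLatticeGamma1 D₀.f ↔ ∃ w ∈ periodLattice D₀.f, z = 2 * w) := by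
  subst hm
  obtain ⟨γ₀, hγ₀⟩ := exists_forall_mem_or_sub_mem_periodLatticeGamma1_of_generator_mod D₀.f hu hN hu₀ hgen
    (fun z hz ↦ two_mul_mem_periodLatticeGamma1_of_four_dvd D₀ h4 hz)
  exact not_index_four_of_two_classes D₀ h₀ hγ₀

/-- **INDEX `4` EXCLUDED when `(ℤ/uv)ˣ` is cyclic** (`N = u²v`, `4 ∣ N`; `uv = q^j, 2q^j` with `q` odd, or `uv = 4`).
[cite: LingOesterle1991, §1 and Thm. 6] -/
theorem not_periodLatticeGamma1_eq_two_mul_of_isCyclic_mod {u v m : ℕ} (hu : u ≠ 0)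
    (hN : (N : ℤ) = (u : ℤ) ^ 2 * v) (hm : u * v = m) [NeZero m] [IsCyclic (ZMod m)ˣ]
    (D₀ : ModularParametrizationData W₀ N) (h₀ : ∀ z ∈ D₀.L.lattice, ∃ w ∈ periodLattice D₀.f, z = D₀.c * w)
    (h4 : 2 ^ 2 ∣ N) :
    ¬ (∀ z : ℂ, z ∈ periodLatticeGamma1 D₀.f ↔ ∃ w ∈ periodLattice D₀.f, z = 2 * w) := by
  obtain ⟨u₀, hu₀, hgen⟩ := exists_forall_units_eq_pow_or_eq_neg_pow_of_isCyclic (m := m)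
  exact not_periodLatticeGamma1_eq_two_mul_of_generator_mod hu hN hm hu₀ hgen D₀ h₀ h4

/-- **INDEX `4` EXCLUDED at `N = u²v` with `uv = 4q`, `q` odd, `(ℤ/q)ˣ` cyclic** — the levels `8q^j` (`u = 2`),
`16q^j` (`u = 4`), `16q²` (`u = 4q`), … beyond the tree's `N = 4q` (`not_periodLatticeGamma1_eq_two_mul_of_four_mul`).
[cite: LingOesterle1991, §1 and Thm. 6] [cite: Stevens1989, §2] -/
theorem not_periodLatticeGamma1_eq_two_mul_of_uv_eq_four_mul {u v q : ℕ} (hu : u ≠ 0)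
    (hN : (N : ℤ) = (u : ℤ) ^ 2 * v) (huv : u * v = 4 * q) (hq : Odd q) [IsCyclic (ZMod q)ˣ]
    (D₀ : ModularParametrizationData W₀ N) (h₀ : ∀ z ∈ D₀.L.lattice, ∃ w ∈ periodLattice D₀.f, z = D₀.c * w) :
    ¬ (∀ z : ℂ, z ∈ periodLatticeGamma1 D₀.f ↔ ∃ w ∈ periodLattice D₀.f, z = 2 * w) := by
  obtain ⟨u₀, hu₀, hgen⟩ := exists_forall_units_eq_pow_or_eq_neg_pow_four_mul hq
  have h4uv : 2 ^ 2 ∣ u * v := ⟨q, by rw [huv]; ring⟩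
  have h4 : 2 ^ 2 ∣ N := h4uv.trans (mul_dvd_of_sq_mul hN)
  exact not_periodLatticeGamma1_eq_two_mul_of_generator_mod hu hN huv hu₀ hgen D₀ h₀ h4

/-- **INDEX `4` EXCLUDED at `N = 8p`, `p` an odd prime** (`u = 2`, `v = 2p`, `uv = 4p`). [cite: LingOesterle1991, Thm. 6] -/
theorem not_periodLatticeGamma1_eq_two_mul_eight_mul_prime {p : ℕ} (hp : p.Prime) (hp2 : p ≠ 2) [NeZero (8 * p)]
    (D₀ : ModularParametrizationData W₀ (8 * p)) (h₀ : ∀ z ∈ D₀.L.lattice, ∃ w ∈ periodLattice D₀.f, z = D₀.c * w) :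
    ¬ (∀ z : ℂ, z ∈ periodLatticeGamma1 D₀.f ↔ ∃ w ∈ periodLattice D₀.f, z = 2 * w) := by
  haveI := ZMod.isCyclic_units_prime hp
  exact not_periodLatticeGamma1_eq_two_mul_of_uv_eq_four_mul (u := 2) (v := 2 * p) two_ne_zero
    (by push_cast; ring) (by ring) (hp.odd_of_ne_two hp2) D₀ h₀

/-- **INDEX `4` EXCLUDED at `N = 16p`, `p` an odd prime** (`u = 4`, `v = p`, `uv = 4p`). [cite: LingOesterle1991, Thm. 6] -/
theorem not_periodLatticeGamma1_eq_two_mul_sixteen_mul_prime {p : ℕ} (hp : p.Prime) (hp2 : p ≠ 2) [NeZero (16 * p)]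
    (D₀ : ModularParametrizationData W₀ (16 * p)) (h₀ : ∀ z ∈ D₀.L.lattice, ∃ w ∈ periodLattice D₀.f, z = D₀.c * w) :
    ¬ (∀ z : ℂ, z ∈ periodLatticeGamma1 D₀.f ↔ ∃ w ∈ periodLattice D₀.f, z = 2 * w) := by
  haveI := ZMod.isCyclic_units_prime hp
  exact not_periodLatticeGamma1_eq_two_mul_of_uv_eq_four_mul (u := 4) (v := p) (by norm_num)
    (by push_cast; ring) (by ring) (hp.odd_of_ne_two hp2) D₀ h₀

/-- **INDEX `4` EXCLUDED at `N = u²v` with `uv = 8`** (`N ∈ {32 (u=4), 64 (u=8)}`): the units of `ℤ/8` are `± 3^k`.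
[cite: LingOesterle1991, Thm. 6] -/
theorem not_periodLatticeGamma1_eq_two_mul_of_uv_eq_eight {u v : ℕ} (hu : u ≠ 0)
    (hN : (N : ℤ) = (u : ℤ) ^ 2 * v) (huv : u * v = 8)
    (D₀ : ModularParametrizationData W₀ N) (h₀ : ∀ z ∈ D₀.L.lattice, ∃ w ∈ periodLattice D₀.f, z = D₀.c * w) :
    ¬ (∀ z : ℂ, z ∈ periodLatticeGamma1 D₀.f ↔ ∃ w ∈ periodLattice D₀.f, z = 2 * w) := by
  have h4uv : 2 ^ 2 ∣ u * v := ⟨2, by rw [huv]; norm_num⟩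
  have h4 : 2 ^ 2 ∣ N := h4uv.trans (mul_dvd_of_sq_mul hN)
  have h3 : IsUnit (3 : ZMod 8) := by decide
  exact not_periodLatticeGamma1_eq_two_mul_of_generator_mod hu hN huv h3 forall_units_zmod_eight D₀ h₀ h4

/-- **INDEX `4` EXCLUDED at `N = u²v` with `uv = 16`** (`N ∈ {32 (u=2), 64 (u=4), 128 (u=8), 256 (u=16)}`): the units of
`ℤ/16` are `± 3^k`. [cite: LingOesterle1991, Thm. 6] -/
theorem not_periodLatticeGamma1_eq_two_mul_of_uv_eq_sixteen {u v : ℕ} (hu : u ≠ 0)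
    (hN : (N : ℤ) = (u : ℤ) ^ 2 * v) (huv : u * v = 16)
    (D₀ : ModularParametrizationData W₀ N) (h₀ : ∀ z ∈ D₀.L.lattice, ∃ w ∈ periodLattice D₀.f, z = D₀.c * w) :
    ¬ (∀ z : ℂ, z ∈ periodLatticeGamma1 D₀.f ↔ ∃ w ∈ periodLattice D₀.f, z = 2 * w) := by
  have h4uv : 2 ^ 2 ∣ u * v := ⟨4, by rw [huv]; norm_num⟩
  have h4 : 2 ^ 2 ∣ N := h4uv.trans (mul_dvd_of_sq_mul hN)
  have h3 : IsUnit (3 : ZMod 16) := by decide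
  exact not_periodLatticeGamma1_eq_two_mul_of_generator_mod hu hN huv h3 forall_units_zmod_sixteen D₀ h₀ h4

/-- **INDEX `4` EXCLUDED at the pure `2`-power levels `N = 32, 64, 128, 256`** (all conductors `2^e` of elliptic curves
over `ℚ`; `32 = 4²·2`, `64 = 8²`, `128 = 8²·2`, `256 = 16²`): the CM / twist-minimal core of C2's line of record
(classes `32a, 64a, 128a–d, 256a–d`). [cite: LingOesterle1991, Thm. 6] [cite: Stevens1989, §2] -/
theorem not_periodLatticeGamma1_eq_two_mul_of_two_power (hN : N = 32 ∨ N = 64 ∨ N = 128 ∨ N = 256)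
    (D₀ : ModularParametrizationData W₀ N) (h₀ : ∀ z ∈ D₀.L.lattice, ∃ w ∈ periodLattice D₀.f, z = D₀.c * w) :
    ¬ (∀ z : ℂ, z ∈ periodLatticeGamma1 D₀.f ↔ ∃ w ∈ periodLattice D₀.f, z = 2 * w) := by
  rcases hN with rfl | rfl | rfl | rfl
  · exact not_periodLatticeGamma1_eq_two_mul_of_uv_eq_eight (u := 4) (v := 2) (by norm_num)
      (by norm_num) (by norm_num) D₀ h₀
  · exact not_periodLatticeGamma1_eq_two_mul_of_uv_eq_eight (u := 8) (v := 1) (by norm_num)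
      (by norm_num) (by norm_num) D₀ h₀
  · exact not_periodLatticeGamma1_eq_two_mul_of_uv_eq_sixteen (u := 8) (v := 2) (by norm_num)
      (by norm_num) (by norm_num) D₀ h₀
  · exact not_periodLatticeGamma1_eq_two_mul_of_uv_eq_sixteen (u := 16) (v := 1) (by norm_num)
      (by norm_num) (by norm_num) D₀ h₀

end IndexFour

/-! ## §6 The half-exponent: `d^{φ(uv)/2} ≡ ±1 (mod uv)`, and the collapse `Λ₁(f) = Λ₀(f)` when a traceless prime is
prime to `φ(uv)/2` -/

section HalfTotient

/-- **Lagrange in `(ℤ/m)ˣ/{±1}`**: for `m > 2` and every unit `x` of `ℤ/m`, `x^{φ(m)/2} = ±1` (the subgroup `{±1}` has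
order `2`, the quotient has order `φ(m)/2`). [folklore] -/
theorem pow_half_totient_eq_one_or_eq_neg_one {m : ℕ} (hm : 2 < m) (x : (ZMod m)ˣ) :
    x ^ (Nat.totient m / 2) = 1 ∨ x ^ (Nat.totient m / 2) = -1 := by
  haveI : NeZero m := ⟨by omega⟩
  haveI : Fact (2 < m) := ⟨hm⟩
  let H : Subgroup (ZMod m)ˣ := Subgroup.zpowers (-1)
  have hord : orderOf (-1 : (ZMod m)ˣ) = 2 := by
    haveI : Fact (Nat.Prime 2) := ⟨Nat.prime_two⟩
    refine orderOf_eq_prime (by simp) fun h ↦ ?_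
    exact ZMod.neg_one_ne_one (congrArg Units.val h)
  have hH : Nat.card H = 2 := by rw [Nat.card_zpowers, hord]
  have hcard : Nat.card ((ZMod m)ˣ ⧸ H) = Nat.totient m / 2 := by
    have h := Subgroup.card_eq_card_quotient_mul_card_subgroup H
    rw [hH, Nat.card_eq_fintype_card, ZMod.card_units_eq_totient] at h
    omega
  have h1 : ((QuotientGroup.mk x : (ZMod m)ˣ ⧸ H)) ^ (Nat.totient m / 2) = 1 := by
    rw [← hcard]; exact pow_card_eq_one'
  rw [← QuotientGroup.mk_pow, QuotientGroup.eq_one_iff] at h1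
  obtain ⟨k, hk⟩ := Subgroup.mem_zpowers_iff.mp h1
  rw [← hk]
  rcases Int.even_or_odd k with ⟨j, rfl⟩ | ⟨j, rfl⟩
  · left
    rw [← two_mul, zpow_mul, zpow_ofNat, ← hord, pow_orderOf_eq_one, one_zpow]
  · right
    rw [zpow_add, zpow_one, zpow_mul, zpow_ofNat, ← hord, pow_orderOf_eq_one, one_zpow, one_mul]

variable (f : CuspForm (Gamma0 N) 2)

/-- **`(φ(uv)/2)·Λ₀(f) ⊆ Λ₁(f)`** (`N = u²v`, `uv > 2`): the Shimura quotient is killed by the exponent of `(ℤ/uv)ˣ/{±1}`.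
[cite: LingOesterle1991, §1 and Thm. 1] -/
theorem half_totient_mul_mem_periodLatticeGamma1_mod {u v : ℕ} (hu : u ≠ 0) (hN : (N : ℤ) = (u : ℤ) ^ 2 * v)
    (huv : 2 < u * v) {z : ℂ} (hz : z ∈ periodLattice f) :
    ((Nat.totient (u * v) / 2 : ℕ) : ℂ) * z ∈ periodLatticeGamma1 f := by
  have hz' : z ∈ (periodLattice f : Set ℂ) := hz
  rw [coe_periodLattice_eq_range] at hz'
  obtain ⟨γ, rfl⟩ := hz'
  refine natCast_mul_cuspSymbol_mem_periodLatticeGamma1_of_pow_apply_mod f hu hN γ _ ?_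
  have h := pow_half_totient_eq_one_or_eq_neg_one huv (isUnit_apply_one_one_mod hN γ).unit
  rcases h with h | h
  · left
    have h' := congrArg Units.val h
    rwa [Units.val_pow_eq_pow_val, IsUnit.unit_spec, Units.val_one] at h'
  · right
    have h' := congrArg Units.val h
    rwa [Units.val_pow_eq_pow_val, IsUnit.unit_spec, Units.val_neg, Units.val_one] at h'

/-- **HALF-EXPONENT COLLAPSE.**  If `p·Λ₀(f) ⊆ Λ₁(f)` (`p` a traceless prime, `p² ∣ N`) and `p` is prime to `φ(uv)/2` for a
factorisation `N = u²v` with `uv > 2`, then `Λ₁(f) = Λ₀(f)`: the `p`-part of `(ℤ/uv)ˣ/{±1}` is trivial.  For `p = 2` this is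
sharper than the `φ(uv)` form: `φ(2q^e)/2 = q^{e−1}(q−1)/2` is ODD for `q ≡ 3 (mod 4)`. [cite: LingOesterle1991, Thm. 1 and Thm. 6] -/
theorem periodLatticeGamma1_eq_of_natMul_mem_of_coprime_half_totient {u v : ℕ} (hu : u ≠ 0)
    (hN : (N : ℤ) = (u : ℤ) ^ 2 * v) (huv : 2 < u * v) {p : ℕ}
    (hp : ∀ z ∈ periodLattice f, (p : ℂ) * z ∈ periodLatticeGamma1 f)
    (hcop : Nat.Coprime p (Nat.totient (u * v) / 2)) : periodLatticeGamma1 f = periodLattice f := by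
  refine le_antisymm (periodLatticeGamma1_le_periodLattice f) fun z hz ↦ ?_
  have hφ := half_totient_mul_mem_periodLatticeGamma1_mod f hu hN huv hz
  generalize Nat.totient (u * v) / 2 = k at hcop hφ
  obtain ⟨a, b, hab⟩ := Nat.isCoprime_iff_coprime.mpr hcop
  have h1 : (((a * p + b * k : ℤ)) : ℂ) = 1 := by rw [hab]; simp
  push_cast at h1
  have key : z = (a : ℂ) * ((p : ℂ) * z) + (b : ℂ) * ((k : ℂ) * z) := by
    linear_combination -z * h1
  rw [key]
  have ha := (periodLatticeGamma1 f).zsmul_mem (hp z hz) a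
  have hb := (periodLatticeGamma1 f).zsmul_mem hφ b
  rw [zsmul_eq_mul] at ha hb
  exact add_mem ha hb

end HalfTotient

/-! ## §7 The collapses at `9 ∣ N` and at `N = 4q^e`, `q ≡ 3 (mod 4)`: Stevens' curve IS the optimal curve -/

section Nine

variable {W₀ : WeierstrassCurve ℚ}

/-- `3Λ₀(f) ⊆ Λ₁(f)` for the newform of an `X₀(N)`-datum at `9 ∣ N` (the traceless prime `3`). [cite: LingOesterle1991, Thm. 6] -/
theorem three_mul_mem_periodLatticeGamma1_of_nine_dvd (D₀ : ModularParametrizationData W₀ N) (h9 : 3 ^ 2 ∣ N)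
    {z : ℂ} (hz : z ∈ periodLattice D₀.f) : (3 : ℂ) * z ∈ periodLatticeGamma1 D₀.f := by
  have h := pMulLatticeLeGamma1OfTracelessPrime_holds N D₀.f D₀.isNewformOf.1 3 Nat.prime_three
    ((dvd_pow_self 3 two_ne_zero).trans h9) (D₀.isNewformOf.1.cuspCoeff_eq_zero_of_sq_dvd Nat.prime_three h9) z hz
  exact_mod_cast h

/-- **STEVENS' CURVE IS THE OPTIMAL CURVE at `N = 9M` with `3 ∤ φ(3M)`** (lattice form): for the newform of any
`X₀(9M)`-datum, `Λ₁(f) = Λ₀(f)` — the Shimura quotient is a `3`-torsion quotient of `(ℤ/3M)ˣ/{±1}` (`u = 3`, `v = M`),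
whose order `φ(3M)` is prime to `3`.  Levels: `N = 9p` with `p ≡ 2 (mod 3)` prime (`φ(3p) = 2(p−1)`), `N = 18, 36, 45, 72,
90, 99, 144, 153, 198, …`; es census E15: every such class has index `1` ✓.  (At `N = 9p` the tree knew only «`≤ 3` classes».)
[cite: LingOesterle1991, Thm. 1 and Thm. 6] [cite: Stevens1989, §2] -/
theorem periodLatticeGamma1_eq_of_nine_mul_of_coprime_totient {M : ℕ} (hN : N = 9 * M)
    (hcop : Nat.Coprime 3 (Nat.totient (3 * M))) (D₀ : ModularParametrizationData W₀ N) :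
    periodLatticeGamma1 D₀.f = periodLattice D₀.f := by
  have hNZ : (N : ℤ) = (3 : ℤ) ^ 2 * M := by rw [hN]; push_cast; ring
  have h9 : 3 ^ 2 ∣ N := ⟨M, by rw [hN]; norm_num⟩
  exact periodLatticeGamma1_eq_of_natMul_mem_of_coprime_totient D₀.f (u := 3) (v := M) (by norm_num) hNZ
    (fun z hz ↦ three_mul_mem_periodLatticeGamma1_of_nine_dvd D₀ h9 hz) hcop

/-- **`N = 9p`, `p ≡ 2 (mod 3)` prime ⟹ `Λ₁(f) = Λ₀(f)`** (`φ(3p) = 2(p − 1)` is prime to `3`).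
[cite: LingOesterle1991, Thm. 1 and Thm. 6] -/
theorem periodLatticeGamma1_eq_of_nine_mul_prime {p : ℕ} (hp : p.Prime) (hp3 : p % 3 = 2) [NeZero (9 * p)]
    (D₀ : ModularParametrizationData W₀ (9 * p)) : periodLatticeGamma1 D₀.f = periodLattice D₀.f := by
  refine periodLatticeGamma1_eq_of_nine_mul_of_coprime_totient rfl ?_ D₀
  have hp3' : Nat.Coprime 3 p := (Nat.coprime_primes Nat.prime_three hp).mpr (by rintro rfl; norm_num at hp3)
  rw [Nat.totient_mul hp3', Nat.totient_prime Nat.prime_three, Nat.totient_prime hp]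
  have h1 : Nat.Coprime 3 (p - 1) := by
    rw [Nat.coprime_comm, Nat.Prime.coprime_iff_not_dvd Nat.prime_three |>.symm.trans Nat.coprime_comm |>.symm]
    omega
  exact Nat.Coprime.mul_right (by norm_num) h1

/-- **STEVENS' CURVE IS THE OPTIMAL CURVE at `N = 4q^e`, `q ≡ 3 (mod 4)` prime** (lattice form): `Λ₁(f) = Λ₀(f)` for the
newform of any `X₀(N)`-datum — `2Λ₀ ⊆ Λ₁` (traceless `2`) and the Shimura quotient is a quotient of `(ℤ/2q^e)ˣ/{±1}` (`u = 2`,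
`v = q^e`), a group of ODD order `q^{e−1}(q−1)/2`.  Levels `N = 28, 44, 76, 92, 108, 124, 172, 188, 236, …`; es census E15 ✓
(index `2` at `N = 4·odd ≤ 356` occurs exactly at `20, 52, 116, 212` — all `q ≡ 1 (mod 4)`).  So the Γ₀/Γ₁ transfer `|c₀| = |c₁|`
(E-an-151) is AUTOMATIC there (tree `natAbs_maninConstant₀_eq_of_periodLatticeGamma1_eq_periodLattice`).
[cite: LingOesterle1991, Thm. 1 and Thm. 6] [cite: Stevens1989, §2] -/
theorem periodLatticeGamma1_eq_of_four_mul_prime_pow {q e : ℕ} (hq : q.Prime) (hq3 : q % 4 = 3) (he : e ≠ 0)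
    (hN : N = 4 * q ^ e) (D₀ : ModularParametrizationData W₀ N) :
    periodLatticeGamma1 D₀.f = periodLattice D₀.f := by
  have hq2 : q ≠ 2 := by rintro rfl; norm_num at hq3
  have hq1 : 3 ≤ q := by have := hq.two_le; omega
  have hNZ : (N : ℤ) = (2 : ℤ) ^ 2 * (q ^ e : ℕ) := by rw [hN]; push_cast; ring
  have h4 : 2 ^ 2 ∣ N := ⟨q ^ e, by rw [hN]; norm_num⟩
  have hqe : 1 ≤ q ^ e := Nat.one_le_pow _ _ hq.pos
  have huv : 2 < 2 * q ^ e := by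
    have : q ≤ q ^ e := by
      calc q = q ^ 1 := (pow_one q).symm
        _ ≤ q ^ e := Nat.pow_le_pow_right hq.pos (Nat.one_le_iff_ne_zero.mpr he)
    omega
  refine periodLatticeGamma1_eq_of_natMul_mem_of_coprime_half_totient D₀.f (u := 2) (v := q ^ e) two_ne_zero hNZ huv
    (fun z hz ↦ two_mul_mem_periodLatticeGamma1_of_four_dvd D₀ h4 hz) ?_
  -- `φ(2q^e)/2 = q^{e-1}(q-1)/2` is odd
  have hcop2q : Nat.Coprime 2 (q ^ e) := (Nat.coprime_primes Nat.prime_two hq |>.mpr (Ne.symm hq2)).pow_right e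
  rw [Nat.totient_mul hcop2q, Nat.totient_two, one_mul, Nat.totient_prime_pow hq (Nat.pos_of_ne_zero he)]
  rw [Nat.coprime_two_left]
  -- q^(e-1) * (q-1) / 2 = q^(e-1) * ((q-1)/2), both factors odd
  have hq1' : (q - 1) % 2 = 0 := by omega
  obtain ⟨r, hr⟩ : ∃ r, q - 1 = 2 * r := ⟨(q - 1) / 2, by omega⟩
  have hr_odd : r % 2 = 1 := by omega
  rw [hr, show q ^ (e - 1) * (2 * r) / 2 = q ^ (e - 1) * r by
    rw [mul_left_comm, Nat.mul_div_cancel_left _ two_pos]]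
  have hqodd : Odd q := hq.odd_of_ne_two hq2
  exact Nat.odd_mul.mpr ⟨hqodd.pow, Nat.odd_iff.mpr hr_odd⟩

/-- **`N = 4p`, `p ≡ 3 (mod 4)` prime ⟹ `Λ₁(f) = Λ₀(f)`.** [cite: LingOesterle1991, Thm. 1 and Thm. 6] -/
theorem periodLatticeGamma1_eq_of_four_mul_prime {p : ℕ} (hp : p.Prime) (hp3 : p % 4 = 3) [NeZero (4 * p)]
    (D₀ : ModularParametrizationData W₀ (4 * p)) : periodLatticeGamma1 D₀.f = periodLattice D₀.f :=
  periodLatticeGamma1_eq_of_four_mul_prime_pow hp hp3 one_ne_zero (by rw [pow_one]) D₀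

end Nine

end Summit.BirchSwinnertonDyer.BirchSwinnertonDyer.Theorems.ManinLocalTwoThree

end
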